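import Summits.BirchSwinnertonDyer.BirchSwinnertonDyer.Theorems.SchneiderFreeAdditiveX3PoitouTateUnramifiedOrthogonalAllLevels
import HarnessLib

/-!
# Poitou–Tate toolkit: Milne I Thm. 4.10(b) `Ker γ¹ ⊆ Im β¹` at a set of places `S` FOLLOWS from the
# same statement at any larger finite set `S' ⊇ S` — it suffices to prove `hE` for all sufficiently
# large `S`

Cell `bsd-schneider-ideate`, seat `bsd-schneider-door-c6` (prover, generation 7).  PARTITION: board row
B6 ∩ X3 ∩ sst-twist, `r = 1` — CONTROL corner (crux `AnticycControlAdditiveK`, stmt-BirchSwinnertonDyer-19295;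
stubs `stub_baseCountTors` / `stub_ptSurj` hinge on the hypothesis `hE` = Milne *ADT* I Thm. 4.10(b) for
`LocalInvariants.canonical K (p^k)`, ALL finite `M`, ALL admissible `S`).  THEOREMS ONLY.  HONEST FRAMING:
no new case of Poitou–Tate and no case of BSD; a reduction in the `S`-variable: any proof of `hE(M, ·)`
for a cofinal family of finite sets of places (e.g. all `S' ⊇ S₀(K, M)`, `S₀` killing the `p`-part of the
class group, or containing a chosen auxiliary set) gives `hE(M, S)` for every admissible `S`.

* **`middleExact_of_middleExact_superset`** — for a family `inv` with `IsPerfect`, `InjectiveAtRealPlaces`,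
  `UnramifiedOrthogonal`; `M` finite `n`-torsion; `S ⊆ S'` finite, `S ⊇ {v ∣ ∞}`, `v ∉ S ⇒ v ∤ n ∧ M`
  unramified at `v`: `hE(M, S') → hE(M, S)`.  Mechanism: Howard's Thm. 2.1.11 (i) at `S'` for the pair
  of Selmer structures `𝓕 ≤ 𝓖`, `𝓖 =` (everything on `S`, unramified off `S`), `𝓕 =` (zero on `S`,
  unramified off `S`) — both unramified outside `S' ⊇ S`, `H¹_𝓖 = H¹_S(K, M)`, `H¹_{𝓕^*} = H¹_S(K, M^D)`
  (Milne I Thm. 2.6) — which the tree derives from `hE(M, S')`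
  (`exists_selmer_sub_mem_of_middleExact`, p483462): the family `t̃ = (t on S, 0 on S' ∖ S)` lies in
  `⊕ 𝓖_v` and is orthogonal to `H¹_{𝓕^*}`, so `t̃ ≡ loc x (mod ⊕ 𝓕_v)` for some `x ∈ H¹_𝓖 = H¹_S(K, M)`,
  i.e. `loc_v x = t_v` on `S`.
* **`middleExact_canonical_of_superset`** — the same for THE invariant maps `LocalInvariants.canonical K n`
  (`canonical_isPerfect`, `canonical_injectiveAtRealPlaces`, `unramifiedOrthogonal_of_isPerfect_allLevels`).

References: [MilneADT2006] I Thm. 2.6, Lemma 4.8, Thm. 4.10 (b); [Howard2004HeegnerKolyvagin] Thm. 2.1.11;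
[Rubin2000] Thm. 1.7.3 (passage to a larger `Σ`).
-/

noncomputable section

open Function NumberField IsDedekindDomain
open scoped NumberField

universe u

set_option linter.dupNamespace false
set_option autoImplicit false

namespace Summit.BirchSwinnertonDyer.BirchSwinnertonDyer.Theorems.SchneiderFreeAdditiveX3.PoitouTateReduction

open Field
open Literature.NumberTheory.GaloisRepresentations Literature.NumberTheory.GaloisCohomology
open Literature.NumberTheory.GaloisRepresentations.DiscreteGaloisModule (mu TateDual tateDual
  localTatePairingZMod unramifiedSubgroup SelmerStructure)

section Superset

variable {K : Type u} [Field K] [NumberField K] {n : ℕ} [NeZero n]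
variable {M : Type u} [AddCommGroup M] [TopologicalSpace M] [DiscreteTopology M] [Finite M]

/-- **Milne I Thm. 4.10(b) `Ker γ¹ ⊆ Im β¹` for `(M, S)` from the same statement for `(M, S')`,
`S ⊆ S'`.**  For a family `inv` of local invariant maps which is perfect at the finite places, injective
at the real places and satisfies Milne I Thm. 2.6 (`UnramifiedOrthogonal`), a finite `n`-torsion `M`, and
finite sets of places `S ⊆ S'` with `S ⊇ {v ∣ ∞}` and `v ∉ S ⇒ v ∤ n ∧ M unramified at v`: if every family
of local classes on `S'` orthogonal to `loc(H¹_{S'}(K, M^D))` is `loc` of a class of `H¹_{S'}(K, M)`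
(hypothesis `hE'`), then every family `t` on `S` orthogonal to `loc(H¹_S(K, M^D))` is `loc` of a class of
`H¹_S(K, M)`.  Proof: Howard Thm. 2.1.11 (i) at `S'` (`exists_selmer_sub_mem_of_middleExact`, from
`hE'`) for `𝓕 ≤ 𝓖` with `𝓖 = (H¹(K_v, M))_{v∈S} ∪ (H¹_ur)_{v∉S}`, `𝓕 = (0)_{v∈S} ∪ (H¹_ur)_{v∉S}`,
applied to `t̃ = (t_v)_{v∈S} ∪ (0)_{v∈S'∖S} ∈ ⊕ 𝓖_v`: `H¹_{𝓕^*}(K, M^D) = H¹_S(K, M^D)` (Milne I 2.6 off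
`S`), so `t̃ ⊥ H¹_{𝓕^*}`; the resulting `x ∈ H¹_𝓖(K, M) = H¹_S(K, M)` has `loc_v x - t_v ∈ 𝓕_v = 0` on `S`.
[cite: MilneADT2006, Ch. I, Thm. 4.10(b) and Thm. 2.6] [cite: Howard2004HeegnerKolyvagin, Thm. 2.1.11 (arXiv:1202.6340 p. 6)] -/
theorem middleExact_of_middleExact_superset (inv : LocalInvariants K n) (hperf : inv.IsPerfect)
    (hreal : inv.InjectiveAtRealPlaces) (hUO : inv.UnramifiedOrthogonal) (ρ : DiscreteGaloisModule K M)
    (hM : ∀ m : M, n • m = 0) {S S' : Finset (Place K)} (hSS' : S ⊆ S')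
    (hinf : ∀ w : InfinitePlace K, (Sum.inl w : Place K) ∈ S)
    (hS : ∀ v : HeightOneSpectrum (𝓞 K), (Sum.inr v : Place K) ∉ S →
      ((n : ℕ) : 𝓞 K) ∉ v.asIdeal ∧ GaloisRep.IsUnramifiedAt v ρ)
    (hE' : ∀ t : Π v : Place K, galoisCohomology (ρ.toLocal v) 1,
      (∀ y : galoisCohomology (ρ.tateDual n) 1,
        (∀ v : HeightOneSpectrum (𝓞 K), (Sum.inr v : Place K) ∉ S' →
          galoisCohomology.localization (ρ.tateDual n) (Sum.inr v) 1 y ∈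
            unramifiedSubgroup (GaloisRep.toLocal v (ρ.tateDual n)) 1) →
        ∑ v ∈ S', localTatePairingZMod ρ n v (inv v) (t v)
          (galoisCohomology.localization (ρ.tateDual n) v 1 y) = 0) →
      ∃ x : galoisCohomology ρ 1,
        (∀ v : HeightOneSpectrum (𝓞 K), (Sum.inr v : Place K) ∉ S' →
          galoisCohomology.localization ρ (Sum.inr v) 1 x ∈ unramifiedSubgroup (GaloisRep.toLocal v ρ) 1) ∧
        ∀ v ∈ S', galoisCohomology.localization ρ v 1 x = t v)
    (t : Π v : Place K, galoisCohomology (ρ.toLocal v) 1)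
    (horth : ∀ y : galoisCohomology (ρ.tateDual n) 1,
      (∀ v : HeightOneSpectrum (𝓞 K), (Sum.inr v : Place K) ∉ S →
        galoisCohomology.localization (ρ.tateDual n) (Sum.inr v) 1 y ∈
          unramifiedSubgroup (GaloisRep.toLocal v (ρ.tateDual n)) 1) →
      ∑ v ∈ S, localTatePairingZMod ρ n v (inv v) (t v)
        (galoisCohomology.localization (ρ.tateDual n) v 1 y) = 0) :
    ∃ x : galoisCohomology ρ 1,
      (∀ v : HeightOneSpectrum (𝓞 K), (Sum.inr v : Place K) ∉ S →
        galoisCohomology.localization ρ (Sum.inr v) 1 x ∈ unramifiedSubgroup (GaloisRep.toLocal v ρ) 1) ∧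
      ∀ v ∈ S, galoisCohomology.localization ρ v 1 x = t v := by
  classical
  -- the two Selmer structures
  let 𝓖 : SelmerStructure ρ := fun v =>
    match v with
    | Sum.inl _ => ⊤
    | Sum.inr v' => if (Sum.inr v' : Place K) ∈ S then ⊤ else unramifiedSubgroup (GaloisRep.toLocal v' ρ) 1
  let 𝓕 : SelmerStructure ρ := fun v => if v ∈ S then ⊥ else 𝓖 v
  have h𝓖inr : ∀ v' : HeightOneSpectrum (𝓞 K), (Sum.inr v' : Place K) ∉ S →
      𝓖 (Sum.inr v') = unramifiedSubgroup (GaloisRep.toLocal v' ρ) 1 := fun v' hv' => by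
    change (if (Sum.inr v' : Place K) ∈ S then ⊤ else unramifiedSubgroup (GaloisRep.toLocal v' ρ) 1) = _
    rw [if_neg hv']
  have h𝓖S : ∀ v : Place K, v ∈ S → 𝓖 v = ⊤ := fun v hv => by
    rcases v with w | v'
    · rfl
    · change (if (Sum.inr v' : Place K) ∈ S then ⊤ else unramifiedSubgroup (GaloisRep.toLocal v' ρ) 1) = _
      rw [if_pos hv]
      rfl
  have h𝓕S : ∀ v : Place K, v ∈ S → 𝓕 v = ⊥ := fun v hv => by
    change (if v ∈ S then ⊥ else 𝓖 v) = _
    rw [if_pos hv]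
  have h𝓕nS : ∀ v : Place K, v ∉ S → 𝓕 v = 𝓖 v := fun v hv => by
    change (if v ∈ S then ⊥ else 𝓖 v) = _
    rw [if_neg hv]
  have hle : 𝓕 ≤ 𝓖 := fun v => by
    by_cases hv : v ∈ S
    · rw [h𝓕S v hv]; exact bot_le
    · rw [h𝓕nS v hv]
  have h𝓖S_ur : 𝓖.IsUnramifiedOutside S := ⟨hinf, h𝓖inr⟩
  have h𝓕S_ur : 𝓕.IsUnramifiedOutside S :=
    ⟨hinf, fun v hv => by rw [h𝓕nS _ hv]; exact h𝓖inr v hv⟩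
  have hS' : ∀ v : HeightOneSpectrum (𝓞 K), (Sum.inr v : Place K) ∉ S' →
      ((n : ℕ) : 𝓞 K) ∉ v.asIdeal ∧ GaloisRep.IsUnramifiedAt v ρ := fun v hv => hS v fun h => hv (hSS' h)
  have hinf' : ∀ w : InfinitePlace K, (Sum.inl w : Place K) ∈ S' := fun w => hSS' (hinf w)
  have h𝓖S'_ur : 𝓖.IsUnramifiedOutside S' := ⟨hinf', fun v hv => h𝓖inr v fun h => hv (hSS' h)⟩
  have h𝓕S'_ur : 𝓕.IsUnramifiedOutside S' := ⟨hinf', fun v hv => h𝓕S_ur.2 v fun h => hv (hSS' h)⟩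
  -- `H¹_{𝓕^*}(K, M^D) = H¹_S(K, M^D)` (Milne I 2.6 off `S`)
  have hdual := hUO.isUnramifiedOutside_dualSelmerStructure ρ hM hS h𝓕S_ur
  -- the extended family
  let t' : Π v : Place K, galoisCohomology (ρ.toLocal v) 1 := fun v => if v ∈ S then t v else 0
  have ht'S : ∀ v ∈ S, t' v = t v := fun v hv => by
    change (if v ∈ S then t v else 0) = t v
    rw [if_pos hv]
  have ht'nS : ∀ v ∉ S, t' v = 0 := fun v hv => by
    change (if v ∈ S then t v else 0) = 0
    rw [if_neg hv]
  have ht' : ∀ v ∈ S', t' v ∈ 𝓖 v := fun v _ => by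
    by_cases hv : v ∈ S
    · rw [h𝓖S v hv]; exact AddSubgroup.mem_top _
    · rw [ht'nS v hv]; exact zero_mem _
  have horth' : ∀ y ∈ (inv.dualSelmerStructure ρ 𝓕).selmerGroup,
      ∑ v ∈ S', localTatePairingZMod ρ n v (inv v) (t' v)
        (galoisCohomology.localization (ρ.tateDual n) v 1 y) = 0 := by
    intro y hy
    rw [SelmerStructure.mem_selmerGroup_iff] at hy
    have hyS : ∀ v : HeightOneSpectrum (𝓞 K), (Sum.inr v : Place K) ∉ S →
        galoisCohomology.localization (ρ.tateDual n) (Sum.inr v) 1 y ∈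
          unramifiedSubgroup (GaloisRep.toLocal v (ρ.tateDual n)) 1 := fun v hv => by
      rw [← hdual.2 v hv]
      exact hy (Sum.inr v)
    rw [← Finset.sum_subset hSS' (fun v _ hv => by rw [ht'nS v hv, map_zero, AddMonoidHom.zero_apply])]
    refine Eq.trans (Finset.sum_congr rfl fun v hv => by rw [ht'S v hv]) (horth y hyS)
  obtain ⟨x, hx, hxt⟩ := exists_selmer_sub_mem_of_middleExact inv hperf hreal hUO ρ hM hS' hE' hle
    h𝓕S'_ur h𝓖S'_ur t' ht' horth'
  rw [SelmerStructure.mem_selmerGroup_iff] at hx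
  refine ⟨x, fun v hv => ?_, fun v hv => ?_⟩
  · have h1 := hx (Sum.inr v)
    rwa [h𝓖inr v hv] at h1
  · have h1 := hxt v (hSS' hv)
    rw [h𝓕S v hv, AddSubgroup.mem_bot, sub_eq_zero, ht'S v hv] at h1
    exact h1

end Superset

/-! ## THE invariant maps -/

section Canonical

variable {K : Type} [Field K] [NumberField K] {n : ℕ} [NeZero n]
variable {M : Type} [AddCommGroup M] [TopologicalSpace M] [DiscreteTopology M] [Finite M]

/-- **For THE invariant maps `LocalInvariants.canonical K n`: Milne I Thm. 4.10(b) for `(M, S')` implies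
it for `(M, S)` whenever `S ⊆ S'`** (`S ⊇ {v ∣ ∞}`, `v ∉ S ⇒ v ∤ n ∧ M` unramified at `v`).  Hence the
hypothesis `hE` of `exists_localInvariants_duality_of_middleExact_canonical` /
`poitouTate_selmerStructure_duality_of_middleExact_canonical_primePow` need only be proved for all
SUFFICIENTLY LARGE admissible `S` (any cofinal family). [cite: MilneADT2006, Ch. I, Thm. 4.10(b) and Thm. 2.6]
[cite: Howard2004HeegnerKolyvagin, Thm. 2.1.11 (arXiv:1202.6340 p. 6)] -/
theorem middleExact_canonical_of_superset (ρ : DiscreteGaloisModule K M) (hM : ∀ m : M, n • m = 0)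
    {S S' : Finset (Place K)} (hSS' : S ⊆ S') (hinf : ∀ w : InfinitePlace K, (Sum.inl w : Place K) ∈ S)
    (hS : ∀ v : HeightOneSpectrum (𝓞 K), (Sum.inr v : Place K) ∉ S →
      ((n : ℕ) : 𝓞 K) ∉ v.asIdeal ∧ GaloisRep.IsUnramifiedAt v ρ)
    (hE' : ∀ t : Π v : Place K, galoisCohomology (ρ.toLocal v) 1,
      (∀ y : galoisCohomology (ρ.tateDual n) 1,
        (∀ v : HeightOneSpectrum (𝓞 K), (Sum.inr v : Place K) ∉ S' →
          galoisCohomology.localization (ρ.tateDual n) (Sum.inr v) 1 y ∈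
            unramifiedSubgroup (GaloisRep.toLocal v (ρ.tateDual n)) 1) →
        ∑ v ∈ S', localTatePairingZMod ρ n v (LocalInvariants.canonical K n v) (t v)
          (galoisCohomology.localization (ρ.tateDual n) v 1 y) = 0) →
      ∃ x : galoisCohomology ρ 1,
        (∀ v : HeightOneSpectrum (𝓞 K), (Sum.inr v : Place K) ∉ S' →
          galoisCohomology.localization ρ (Sum.inr v) 1 x ∈ unramifiedSubgroup (GaloisRep.toLocal v ρ) 1) ∧
        ∀ v ∈ S', galoisCohomology.localization ρ v 1 x = t v)
    (t : Π v : Place K, galoisCohomology (ρ.toLocal v) 1)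
    (horth : ∀ y : galoisCohomology (ρ.tateDual n) 1,
      (∀ v : HeightOneSpectrum (𝓞 K), (Sum.inr v : Place K) ∉ S →
        galoisCohomology.localization (ρ.tateDual n) (Sum.inr v) 1 y ∈
          unramifiedSubgroup (GaloisRep.toLocal v (ρ.tateDual n)) 1) →
      ∑ v ∈ S, localTatePairingZMod ρ n v (LocalInvariants.canonical K n v) (t v)
        (galoisCohomology.localization (ρ.tateDual n) v 1 y) = 0) :
    ∃ x : galoisCohomology ρ 1,
      (∀ v : HeightOneSpectrum (𝓞 K), (Sum.inr v : Place K) ∉ S →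
        galoisCohomology.localization ρ (Sum.inr v) 1 x ∈ unramifiedSubgroup (GaloisRep.toLocal v ρ) 1) ∧
      ∀ v ∈ S, galoisCohomology.localization ρ v 1 x = t v :=
  middleExact_of_middleExact_superset _ LocalInvariants.canonical_isPerfect
    LocalInvariants.canonical_injectiveAtRealPlaces
    (unramifiedOrthogonal_of_isPerfect_allLevels _ LocalInvariants.canonical_isPerfect) ρ hM hSS' hinf hS
    hE' t horth

end Canonical

end Summit.BirchSwinnertonDyer.BirchSwinnertonDyer.Theorems.SchneiderFreeAdditiveX3.PoitouTateReduction

end
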